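import Summits.ABC.ABC.Theorems.IneffectiveSubspaceTowerFourGivesDepthCounted

/-!
# `UniformSadicGivesPrimePowerRadical` (stmt-ABC-15167, route ABC/IneffectiveSubspace)

This file proves the support item `UniformSadicGivesPrimePowerRadical` of the route file
`Summits/ABC/ABC/Theses/IneffectiveSubspace.lean`:

`UniformSadicTowerFour → PrimePowerRadical`,

i.e. crux #2 (Ridout at level four, uniform over `|S| ≤ K`) at `K = 1`, `S = {q}` gives crux #3
(abc for the triples `(1, q^k − 1, q^k)` with a constant depending on `q`).

**Proof.**  Fix a prime `q` and `ε₀ > 0`; put `ε := min(ε₀, 1)/4` and take `C = C(1, ε)` from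
`UniformSadicTowerFour`.  For `k ≥ 1` let `m := q^k − 1` and lift the abc triple `(1, m, q^k)` to
the level-4 tower by `x = (1,1,1,1)`, `y =` the optimal lift of `m`
(`TowerFourGivesDepthCounted.exists_lift`: `∏ yᵢ^(i+1) = m`, `v_p(∏ yᵢ) = ⌈v_p(m)/4⌉`),
`z = (q^k, 1, 1, 1)`.  With `S = {q}` and `Y := ∏ yᵢ` one has `∏ xᵢyᵢzᵢ = Y · q^k` with `q ∤ Y`,
so the bracket `(∏_{p∈S} p) · {∏ xᵢyᵢzᵢ}^S` equals `q · Y` and the tower inequality reads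
`q^k < C · (qY)^(1+ε)`.  Depth bound: `Y⁴ ≤ m · rad(m)³` (prime by prime `4⌈v/4⌉ ≤ v + 3`), and
`m < q^k`.  Taking logarithms, `log q^k < log C + (1+ε)(log q + log Y)` and
`4 log Y ≤ log q^k + 3 log rad(m)` give
`(3 − ε) log q^k < 4(log C + (1+ε) log q) + 3(1+ε) log rad(m)`; since
`3(1+ε) ≤ (3−ε)(1+ε₀)` and `log q, log rad(m) ≥ 0` this yields
`log q^k < A + (1+ε₀)(log q + log rad(m))` with `A := 4(log C + (1+ε) log q)/(3−ε)`, and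
`rad(1 · m · q^k) = rad(m) · q`.  The constant `exp A` depends on `q` (uniformity in `q` is not
claimed by `PrimePowerRadical`).

Sources: P. Vojta, *On the ABC conjecture and diophantine approximation by rational points*,
Amer. J. Math. 122 (2000), §3.1 [Vojta2000ABC] (the lift); D. Ridout, Mathematika 5 (1958)
[Ridout1958]; the item text of stmt-ABC-15167.  Uses only Mathlib and the lift lemma of
`Theorems/IneffectiveSubspaceTowerFourGivesDepthCounted.lean`.
-/

-- `Summit.<Summit>.<Problem>` is the mandated summit-side namespace (CONVENTIONS §2); for the
-- single-conjunct summit `ABC` the two coincide, so the duplicate `ABC.ABC` is deliberate.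
set_option linter.dupNamespace false

namespace Summit.ABC.ABC.Theorems

open scoped BigOperators
open Finset

/-- A prime `q` does not divide `q^k − 1` when `k ≠ 0`. [folklore] -/
theorem UniformSadicGivesPrimePowerRadical.not_dvd_pow_sub_one {q k : ℕ} (hq : q.Prime)
    (hk : k ≠ 0) : ¬ q ∣ q ^ k - 1 := by
  intro h
  have h1 : q ∣ q ^ k := dvd_pow_self q hk
  have h2 : q ∣ q ^ k - (q ^ k - 1) := Nat.dvd_sub h1 h
  have hpos : 1 ≤ q ^ k := Nat.one_le_pow _ _ hq.pos
  have h3 : q ^ k - (q ^ k - 1) = 1 := by omega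
  rw [h3] at h2
  exact hq.one_lt.ne' (Nat.dvd_one.mp h2)

/-- **Depth bound for the optimal level-4 lift.**  If `m ≠ 0`, `Y ≠ 0` and
`v_p(Y) = ⌈v_p(m)/4⌉` for every `p`, then `Y⁴ ≤ m · rad(m)³` (prime by prime:
`4⌈v/4⌉ ≤ v + 3`). [folklore] -/
theorem UniformSadicGivesPrimePowerRadical.lift_pow_four_le {m Y : ℕ} (hm : m ≠ 0) (hY : Y ≠ 0)
    (hYf : ∀ p, Y.factorization p = (m.factorization p + 3) / 4) :
    Y ^ 4 ≤ m * (∏ p ∈ m.primeFactors, p) ^ 3 := by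
  -- `Y` and `m` have the same prime factors
  have hpf : Y.primeFactors = m.primeFactors := by
    ext p
    rw [← Nat.support_factorization, ← Nat.support_factorization, Finsupp.mem_support_iff,
      Finsupp.mem_support_iff, hYf]
    omega
  -- both sides as products over `m.primeFactors`
  have hYprod : Y = ∏ p ∈ m.primeFactors, p ^ ((m.factorization p + 3) / 4) := by
    conv_lhs => rw [Nat.prod_primeFactors_pow_factorization hY, hpf]
    exact Finset.prod_congr rfl fun p _ => by rw [hYf]
  calc Y ^ 4 = ∏ p ∈ m.primeFactors, p ^ (4 * ((m.factorization p + 3) / 4)) := by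
        rw [hYprod, ← Finset.prod_pow]
        exact Finset.prod_congr rfl fun p _ => by rw [← pow_mul, mul_comm]
    _ ≤ ∏ p ∈ m.primeFactors, p ^ (m.factorization p + 3) := by
        refine Finset.prod_le_prod (fun p _ => Nat.zero_le _) fun p hp => ?_
        exact Nat.pow_le_pow_right (Nat.prime_of_mem_primeFactors hp).pos (Nat.mul_div_le _ 4)
    _ = (∏ p ∈ m.primeFactors, p ^ m.factorization p) * ∏ p ∈ m.primeFactors, p ^ 3 := by
        rw [← Finset.prod_mul_distrib]
        exact Finset.prod_congr rfl fun p _ => pow_add _ _ _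
    _ = m * (∏ p ∈ m.primeFactors, p) ^ 3 := by
        rw [← Nat.prod_primeFactors_pow_factorization hm, Finset.prod_pow]

/-- **The `S = {q}` bracket.**  For a prime `q`, `k ≠ 0` and `q ∤ Y ≠ 0`, with `P := Y · q^k`:
`(∏_{p ∈ {q}} p) · ∏_{p ∈ P.primeFactors ∖ {q}} p^{v_p(P)} = q · Y`. [folklore] -/
theorem UniformSadicGivesPrimePowerRadical.bracket_singleton {q k Y : ℕ} (hq : q.Prime)
    (hk : k ≠ 0) (hY : Y ≠ 0) (hqY : ¬ q ∣ Y) :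
    (∏ p ∈ ({q} : Finset ℕ), p) *
        ∏ p ∈ (Y * q ^ k).primeFactors \ {q}, p ^ (Y * q ^ k).factorization p = q * Y := by
  have hqk : q ^ k ≠ 0 := pow_ne_zero _ hq.ne_zero
  have hnot : q ∉ Y.primeFactors := fun h => hqY (Nat.dvd_of_mem_primeFactors h)
  have hpf : (Y * q ^ k).primeFactors \ {q} = Y.primeFactors := by
    rw [Nat.primeFactors_mul hY hqk, Nat.primeFactors_prime_pow hk hq,
      Finset.union_sdiff_cancel_right (Finset.disjoint_singleton_right.mpr hnot)]
  rw [Finset.prod_singleton, hpf]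
  congr 1
  calc ∏ p ∈ Y.primeFactors, p ^ (Y * q ^ k).factorization p
      = ∏ p ∈ Y.primeFactors, p ^ Y.factorization p := by
        refine Finset.prod_congr rfl fun p hp => ?_
        have hpq : q ≠ p := fun h => hnot (h ▸ hp)
        rw [Nat.factorization_mul hY hqk, Finsupp.add_apply, hq.factorization_pow,
          Finsupp.single_apply, if_neg hpq, add_zero]
    _ = Y := (Nat.prod_primeFactors_pow_factorization hY).symm

/-- `rad(1 · (q^k − 1) · q^k) = rad(q^k − 1) · q` for a prime `q` and `k ≠ 0`
(`q ∤ q^k − 1`, so the prime factors split disjointly). [folklore] -/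
theorem UniformSadicGivesPrimePowerRadical.rad_one_pow_sub_one_pow {q k : ℕ} (hq : q.Prime)
    (hk : k ≠ 0) :
    Literature.NumberTheory.DiophantineGeometry.rad 1 (q ^ k - 1) (q ^ k) =
      (∏ p ∈ (q ^ k - 1).primeFactors, p) * q := by
  have hc : 1 < q ^ k := Nat.one_lt_pow hk hq.one_lt
  have hm : q ^ k - 1 ≠ 0 := by omega
  have hqk : q ^ k ≠ 0 := pow_ne_zero _ hq.ne_zero
  have hnot : q ∉ (q ^ k - 1).primeFactors := fun h =>
    UniformSadicGivesPrimePowerRadical.not_dvd_pow_sub_one hq hk (Nat.dvd_of_mem_primeFactors h)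
  rw [Literature.NumberTheory.DiophantineGeometry.rad_def, one_mul,
    Nat.radical_eq_prod_primeFactors, Nat.primeFactors_mul hm hqk,
    Nat.primeFactors_prime_pow hk hq,
    Finset.prod_union (Finset.disjoint_singleton_right.mpr hnot), Finset.prod_singleton]

/-- **Logarithmic bookkeeping.**  From the tower inequality in logarithms
`Lc < LC + (1+ε)(Lq + LY)` and the depth bound `4·LY ≤ Lc + 3·Lr`, with `0 < ε ≤ 1/4`,
`4ε ≤ ε₀` and `Lq, Lr ≥ 0`, one gets `Lc < 4(LC + (1+ε)Lq)/(3−ε) + (1+ε₀)(Lq + Lr)`. [folklore] -/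
theorem UniformSadicGivesPrimePowerRadical.log_bookkeeping {ε ε₀ Lc LC Lq LY Lr : ℝ}
    (hε : 0 < ε) (hε1 : ε ≤ 1 / 4) (hε4 : 4 * ε ≤ ε₀) (hε₀ : 0 < ε₀) (hLq : 0 ≤ Lq)
    (hLr : 0 ≤ Lr) (h1 : Lc < LC + (1 + ε) * (Lq + LY)) (h2 : 4 * LY ≤ Lc + 3 * Lr) :
    Lc < 4 / (3 - ε) * (LC + (1 + ε) * Lq) + (1 + ε₀) * (Lq + Lr) := by
  have h3ε : 0 < 3 - ε := by linarith
  have h3ε' : (3 - ε) ≠ 0 := h3ε.ne'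
  have h3 : (1 + ε) * (4 * LY) ≤ (1 + ε) * (Lc + 3 * Lr) :=
    mul_le_mul_of_nonneg_left h2 (by linarith)
  -- `(3 − ε)·Lc < 4·LC + 4(1+ε)·Lq + 3(1+ε)·Lr`
  have h4 : (3 - ε) * Lc < 4 * (LC + (1 + ε) * Lq) + 3 * (1 + ε) * Lr := by linarith
  have hcoef : 3 * (1 + ε) ≤ (3 - ε) * (1 + ε₀) := by
    nlinarith [mul_le_mul_of_nonneg_right hε1 hε₀.le]
  have h5 : 3 * (1 + ε) * Lr ≤ (3 - ε) * (1 + ε₀) * Lr := mul_le_mul_of_nonneg_right hcoef hLr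
  have h6 : 0 ≤ (3 - ε) * (1 + ε₀) * Lq := mul_nonneg (mul_nonneg h3ε.le (by linarith)) hLq
  have hA : (3 - ε) * (4 / (3 - ε) * (LC + (1 + ε) * Lq)) = 4 * (LC + (1 + ε) * Lq) := by
    field_simp
  refine lt_of_mul_lt_mul_left ?_ h3ε.le
  rw [mul_add, hA]
  linarith

/-- **Support item `UniformSadicGivesPrimePowerRadical`** (stmt-ABC-15167):
`UniformSadicTowerFour → PrimePowerRadical`.  Crux #2 at `K = 1`, `S = {q}`, applied to the
level-4 point `x = 1`, `y =` optimal lift of `q^k − 1`, `z = (q^k, 1, 1, 1)`, followed by the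
depth bound `Y⁴ ≤ m·rad(m)³` and logarithmic bookkeeping; constant
`exp(4(log C(1,ε) + (1+ε) log q)/(3−ε))` with `ε = min(ε₀,1)/4`. [cite: Vojta2000ABC, §3.1] -/
theorem uniformSadicGivesPrimePowerRadical_proof :
    Summit.ABC.ABC.Theses.IneffectiveSubspace.UniformSadicGivesPrimePowerRadical := by
  unfold Summit.ABC.ABC.Theses.IneffectiveSubspace.UniformSadicGivesPrimePowerRadical
    Summit.ABC.ABC.Theses.IneffectiveSubspace.UniformSadicTowerFour
    Summit.ABC.ABC.Theses.IneffectiveSubspace.PrimePowerRadical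
  intro hT q hq ε₀ hε₀
  -- the level-4 exponent `ε = min(ε₀, 1) / 4`
  obtain ⟨ε, hε, hε1, hε4⟩ : ∃ ε : ℝ, 0 < ε ∧ ε ≤ 1 / 4 ∧ 4 * ε ≤ ε₀ :=
    ⟨min ε₀ 1 / 4, by positivity, by have := min_le_right ε₀ 1; linarith,
      by have := min_le_left ε₀ 1; linarith⟩
  obtain ⟨C, hC, hTow⟩ := hT 1 ε hε
  have hq0 : (0 : ℝ) < q := by exact_mod_cast hq.pos
  have hLq : 0 ≤ Real.log q := Real.log_nonneg (by exact_mod_cast hq.one_le)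
  refine ⟨Real.exp (4 / (3 - ε) * (Real.log C + (1 + ε) * Real.log q)), Real.exp_pos _,
    fun k hk => ?_⟩
  have hk0 : k ≠ 0 := by omega
  -- `c = q^k > 1`, `m = q^k − 1 ≠ 0`, `q ∤ m`
  have hc1 : 1 < q ^ k := Nat.one_lt_pow hk0 hq.one_lt
  have hm0 : q ^ k - 1 ≠ 0 := by omega
  have hqm : ¬ q ∣ q ^ k - 1 := UniformSadicGivesPrimePowerRadical.not_dvd_pow_sub_one hq hk0
  -- the lifted point `(x, y, z)` of the level-4 tower
  obtain ⟨y, hy0, hym, hyf⟩ := TowerFourGivesDepthCounted.exists_lift hm0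
  obtain ⟨x, hx⟩ : ∃ x : Fin 4 → ℕ, x = fun _ => 1 := ⟨_, rfl⟩
  obtain ⟨z, hz⟩ : ∃ z : Fin 4 → ℕ, z = ![q ^ k, 1, 1, 1] := ⟨_, rfl⟩
  have hqk0 : 0 < q ^ k := by omega
  have hx0 : ∀ i, 0 < x i := fun i => by rw [hx]; exact Nat.one_pos
  have hz0 : ∀ i, 0 < z i := fun i => by
    rw [hz]; fin_cases i <;> simp [hqk0]
  have hxprod : ∏ i, x i ^ (i.val + 1) = 1 := by rw [hx]; simp
  have hzprod : ∏ i, z i ^ (i.val + 1) = q ^ k := by rw [hz]; simp [Fin.prod_univ_four]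
  have hxP : ∏ i, x i = 1 := by rw [hx]; simp
  have hzP : ∏ i, z i = q ^ k := by rw [hz]; simp [Fin.prod_univ_four]
  set Y := ∏ i, y i with hYdef
  have hY0 : Y ≠ 0 := (Finset.prod_pos fun i _ => hy0 i).ne'
  have hP : ∏ i, x i * y i * z i = Y * q ^ k := by
    rw [Finset.prod_mul_distrib, Finset.prod_mul_distrib, hxP, hzP, one_mul]
  have hqY : ¬ q ∣ Y := fun h => by
    have h' := hq.factorization_pos_of_dvd hY0 h
    rw [hyf, Nat.factorization_eq_zero_of_not_dvd hqm] at h'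
    norm_num at h'
  -- the tower inequality at `K = 1`, `S = {q}`
  have key := hTow {q} (by simp) (by simpa using hq) x y z (fun i => ⟨hx0 i, hy0 i, hz0 i⟩)
    (by rw [hxprod, hym, hzprod]; omega) (by rw [hxprod]; exact Nat.coprime_one_left _)
  rw [hzprod, hP, UniformSadicGivesPrimePowerRadical.bracket_singleton hq hk0 hY0 hqY] at key
  -- the depth bound, the radical, and `r := rad(q^k − 1) ≥ 1`
  have hY4 := UniformSadicGivesPrimePowerRadical.lift_pow_four_le hm0 hY0 hyf
  rw [UniformSadicGivesPrimePowerRadical.rad_one_pow_sub_one_pow hq hk0]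
  have hr0 : 0 < ∏ p ∈ (q ^ k - 1).primeFactors, p :=
    Finset.prod_pos fun p hp => (Nat.prime_of_mem_primeFactors hp).pos
  generalize hr : (∏ p ∈ (q ^ k - 1).primeFactors, p) = r at hY4 hr0 ⊢
  -- pass to real numbers
  have hcR : (0 : ℝ) < ((q ^ k : ℕ) : ℝ) := by exact_mod_cast hqk0
  have hYR : (0 : ℝ) < (Y : ℝ) := by exact_mod_cast Nat.pos_of_ne_zero hY0
  have hrR : (0 : ℝ) < (r : ℝ) := by exact_mod_cast hr0
  have hLr : 0 ≤ Real.log r := Real.log_nonneg (by exact_mod_cast hr0)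
  -- (1) logarithm of the tower inequality
  have h1 : Real.log ((q ^ k : ℕ) : ℝ) < Real.log C + (1 + ε) * (Real.log q + Real.log Y) := by
    have hqYR : (0 : ℝ) < ((q * Y : ℕ) : ℝ) := by
      rw [Nat.cast_mul]; exact mul_pos hq0 hYR
    have h := Real.log_lt_log hcR key
    rwa [Real.log_mul hC.ne' (Real.rpow_pos_of_pos hqYR _).ne', Real.log_rpow hqYR,
      Nat.cast_mul, Real.log_mul hq0.ne' hYR.ne'] at h
  -- (2) logarithm of the depth bound (with `m ≤ q^k`)
  have h2 : 4 * Real.log Y ≤ Real.log ((q ^ k : ℕ) : ℝ) + 3 * Real.log r := by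
    have hmR : (0 : ℝ) < ((q ^ k - 1 : ℕ) : ℝ) := by exact_mod_cast Nat.pos_of_ne_zero hm0
    have hcast : ((Y ^ 4 : ℕ) : ℝ) ≤ (((q ^ k - 1) * r ^ 3 : ℕ) : ℝ) := Nat.cast_le.mpr hY4
    rw [Nat.cast_pow, Nat.cast_mul, Nat.cast_pow] at hcast
    have hlog := Real.log_le_log (by positivity) hcast
    rw [Real.log_pow, Real.log_mul hmR.ne' (by positivity), Real.log_pow] at hlog
    have hmc : Real.log ((q ^ k - 1 : ℕ) : ℝ) ≤ Real.log ((q ^ k : ℕ) : ℝ) :=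
      Real.log_le_log hmR (by exact_mod_cast Nat.sub_le _ _)
    push_cast [Nat.cast_ofNat] at hlog
    linarith
  -- (3) bookkeeping and exponentiation
  have h3 := UniformSadicGivesPrimePowerRadical.log_bookkeeping hε hε1 hε4 hε₀ hLq hLr h1 h2
  have hrqR : (0 : ℝ) < ((r * q : ℕ) : ℝ) := by rw [Nat.cast_mul]; exact mul_pos hrR hq0
  have hR : (0 : ℝ) < Real.exp (4 / (3 - ε) * (Real.log C + (1 + ε) * Real.log q)) *
      ((r * q : ℕ) : ℝ) ^ (1 + ε₀) :=
    mul_pos (Real.exp_pos _) (Real.rpow_pos_of_pos hrqR _)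
  refine (Real.log_lt_log_iff hcR hR).1 ?_
  rw [Real.log_mul (Real.exp_pos _).ne' (Real.rpow_pos_of_pos hrqR _).ne', Real.log_exp,
    Real.log_rpow hrqR, Nat.cast_mul, Real.log_mul hrR.ne' hq0.ne']
  linarith

end Summit.ABC.ABC.Theorems
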